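import Summits.ResolutionOfSingularities.ResolutionOfSingularities.Theorems.FrobeniusClosingPatchingRelPerfectMonomialFamilyBookkeeping
import Summits.ResolutionOfSingularities.ResolutionOfSingularities.Theorems.FrobeniusClosingPatchingRelPerfectMonomialPairPrincipalization
import HarnessLib

/-!
# Crux `PatchingRelPerfect` (stmt-ResolutionOfSingularities-16161), chain w52 — R4 support:
# PRINCIPALIZATION OF MONOMIAL IDEALS (finite sums of monomials), part 2 (the theorem)

[OURS · L1 W5.2 · R4 support «monomial cleanup»] **Every finite sum of monomial ideals
`Σ_i monomialIdeal (𝓐 i)` (`𝓐 : Fin r → List (X.IdealSheafData × ℕ)`, all on one simple normal crossings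
boundary `Es` of a locally Noetherian scheme `X`) is made locally principal by a finite sequence of
blowings up of codimension-two strata `V(K) ∩ V(L)` of the successive snc boundaries**
(`exists_centreSeq_principalize_family`; exponent-function form `exists_centreSeq_principalize_ofFun`;
corollary `exists_centreSeq_isLocallyPrincipal_comap_finsetSup`: the total transform of the sum is
locally principal on a regular scheme).  The pair theorem (`…MonomialPairPrincipalization.lean`) is run
one incomparable index pair `(i, j)` at a time, the WHOLE family being transformed along (explicit step
`exists_step_explicit` exposing the blown-up stratum); comparabilities already achieved persist
(`badPairs_transformExp_eq_empty`, part 1), so the measure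
`(numBad 𝓐, maxVal (𝓐 i) (𝓐 j), numMax (𝓐 i) (𝓐 j))` decreases lexicographically (`family_aux`).  The
centres lie in the union of the PAIRWISE cosupports `pairSupports 𝓐` — so for the chain's companion format
this serves boundaries lying over the closed point (exceptional configurations), not a bare `𝔪`-primary
monomial ideal of `S`.  Any dimension, any characteristic, no base field, no excellence; fact-free.
Nothing here is a statement of the manuscript under review.

## References

* R. Goward, *A simple algorithm for principalization of monomial ideals*, Trans. AMS 357 (2005),
  §2. [Goward2005]
* J. Kollár, *Lectures on Resolution of Singularities* (2007), (3.111) Step 3. [Kollar2007]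
-/

-- `Summit.<Summit>.<Sub>.Theorems` with `Sub = Summit` (single-conjunct summit, D-0017)
set_option linter.dupNamespace false

noncomputable section

open CategoryTheory AlgebraicGeometry TopologicalSpace IsLocalRing
open Literature.AlgebraicGeometry.Resolution

namespace Summit.ResolutionOfSingularities.ResolutionOfSingularities.Theorems

namespace MonomialCleanup

universe u

/-! ## The pair step with the stratum exposed -/

section Step

variable {X : Scheme.{u}} [IsLocallyNoetherian X] {A B : List (X.IdealSheafData × ℕ)}

/-- **The blow-up step of the pair, with the blown-up stratum exposed** (so that other exponent lists
can be transformed along): some bad pair `(K, L)` and the set `T = {K, L}` such that blowing up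
`V(K) ∩ V(L)` makes the measure `(maxVal, numMax)` of `(A, B)` drop lexicographically.
[cite: Kollar2007, (3.111) Step 3] -/
theorem exists_step_explicit (hE : HasSNC (boundaryOf A)) (hAB : boundaryOf A = boundaryOf B)
    (hex : ∃ p ∈ badPairs A B, expOf A p.1 - expOf B p.1 = maxVal A B) :
    ∃ (K L : X.IdealSheafData) (T : Finset X.IdealSheafData),
      (K, L) ∈ badPairs A B ∧ (∀ G, G ∈ T ↔ G = K ∨ G = L) ∧
      (maxVal (transformExp A (blowup.π (T.sup id)) T 0) (transformExp B (blowup.π (T.sup id)) T 0) <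
          maxVal A B ∨
        (maxVal (transformExp A (blowup.π (T.sup id)) T 0) (transformExp B (blowup.π (T.sup id)) T 0) =
            maxVal A B ∧
          numMax (transformExp A (blowup.π (T.sup id)) T 0) (transformExp B (blowup.π (T.sup id)) T 0) <
            numMax A B)) := by
  classical
  obtain ⟨p₀, hp₀, hp₀M⟩ := hex
  set K := p₀.1 with hKdef
  -- choose `L` maximizing `b_L - a_L` among the bad partners of `K`
  set partners := (badPairs A B).filter fun p => p.1 = K with hpartners
  have hne : partners.Nonempty := ⟨p₀, Finset.mem_filter.mpr ⟨hp₀, rfl⟩⟩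
  obtain ⟨p₁, hp₁, hp₁max⟩ := Finset.exists_max_image partners (fun p => expOf B p.2 - expOf A p.2) hne
  obtain ⟨hp₁bad, hp₁K⟩ := Finset.mem_filter.mp hp₁
  set L := p₁.2 with hLdef
  have hKL : (K, L) ∈ badPairs A B := by
    have : p₁ = (K, L) := Prod.ext hp₁K rfl
    rwa [this] at hp₁bad
  have hLmax : ∀ H ∈ sheaves B, (K, H) ∈ badPairs A B → expOf B H - expOf A H ≤ expOf B L - expOf A L :=
    fun H _ hKH => hp₁max (K, H) (Finset.mem_filter.mpr ⟨hKH, rfl⟩)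
  have hKM : expOf A K - expOf B K = maxVal A B := hp₀M
  have hvalKL : value A B (K, L) = maxVal A B := by
    refine le_antisymm (value_le_maxVal hKL) ?_
    rw [value, ← hKM]
    exact le_max_left _ _
  set T : Finset X.IdealSheafData := {K, L} with hTdef
  have hTKL : ∀ G, G ∈ T ↔ G = K ∨ G = L := fun G => by
    rw [hTdef, Finset.mem_insert, Finset.mem_singleton]
  refine ⟨K, L, T, hKL, hTKL, ?_⟩
  set C : X.IdealSheafData := T.sup id with hC
  have hπ : IsBlowup (blowup.π C) (T.sup id) := blowup.isBlowup C
  set A' := transformExp A (blowup.π C) T 0 with hA'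
  set B' := transformExp B (blowup.π C) T 0 with hB'
  have hcl := step_classify hE hAB hKL hKM hLmax hTKL hπ
  -- every new value is `≤ M`
  have hle : maxVal A' B' ≤ maxVal A B := by
    refine Finset.sup_le fun p' hp' => ?_
    rcases hcl p' hp' with h | ⟨p, hp, -, -, hv⟩
    · exact h.le
    · rw [hv]; exact value_le_maxVal hp
  rcases hle.lt_or_eq with hlt | heq
  · exact Or.inl hlt
  · refine Or.inr ⟨heq, ?_⟩
    let st : X.IdealSheafData × X.IdealSheafData → (blowup C).IdealSheafData × (blowup C).IdealSheafData :=
      fun p => (strictTransformIdeal (blowup.π C) (T.sup id) p.1, strictTransformIdeal (blowup.π C) (T.sup id) p.2)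
    have hsub : (badPairs A' B').filter (fun p' => value A' B' p' = maxVal A' B') ⊆
        (((badPairs A B).filter fun p => value A B p = maxVal A B).erase (K, L)).image st := by
      intro p' hp'
      obtain ⟨hp'bad, hp'v⟩ := Finset.mem_filter.mp hp'
      rcases hcl p' hp'bad with h | ⟨p, hp, hpne, hpeq, hv⟩
      · rw [hp'v, heq] at h; exact absurd h (lt_irrefl _)
      · refine Finset.mem_image.mpr ⟨p, Finset.mem_erase.mpr ⟨hpne, Finset.mem_filter.mpr ⟨hp, ?_⟩⟩, hpeq.symm⟩
        rw [← hv, hp'v, heq]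
    rw [numMax, numMax]
    calc ((badPairs A' B').filter fun p' => value A' B' p' = maxVal A' B').card
        ≤ ((((badPairs A B).filter fun p => value A B p = maxVal A B).erase (K, L)).image st).card :=
          Finset.card_le_card hsub
      _ ≤ (((badPairs A B).filter fun p => value A B p = maxVal A B).erase (K, L)).card :=
          Finset.card_image_le
      _ < ((badPairs A B).filter fun p => value A B p = maxVal A B).card :=
          Finset.card_erase_lt_of_mem (Finset.mem_filter.mpr ⟨hKL, hvalKL⟩)

end Step

/-! ## The family step -/

section FamilyStep

variable {X : Scheme.{u}} [IsLocallyNoetherian X] {r : ℕ} {Es : List X.IdealSheafData}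
  {𝓐 : Fin r → List (X.IdealSheafData × ℕ)}

/-- **One step for the family**: if the incomparable pair `(𝓐 i, 𝓐 j)` attains its maximal value on the
`i`-side, blowing up the stratum of a well-chosen bad pair of it and transforming EVERY member along
yields a family on the (chosen) blow-up with: regular centre inside `pairSupports 𝓐`, a common snc
boundary, the total transforms, pairwise cosupports over the old ones, `numBad` not increased — and
dropped if `(i, j)` became comparable —, and the measure of `(i, j)` lexicographically smaller.
[cite: Goward2005, §2] -/
theorem exists_familyStep (hEs : HasSNC Es) (hb : ∀ k, boundaryOf (𝓐 k) = Es) {i j : Fin r}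
    (hex : ∃ p ∈ badPairs (𝓐 i) (𝓐 j), expOf (𝓐 i) p.1 - expOf (𝓐 j) p.1 = maxVal (𝓐 i) (𝓐 j)) :
    ∃ (C : X.IdealSheafData) (Es' : List (blowup C).IdealSheafData)
      (𝓐' : Fin r → List ((blowup C).IdealSheafData × ℕ)),
      Scheme.IsRegular C.subscheme ∧ (C.support : Set X) ⊆ pairSupports 𝓐 ∧
      HasSNC Es' ∧ (∀ k, boundaryOf (𝓐' k) = Es') ∧
      (∀ k, (monomialIdeal (𝓐 k)).comap (blowup.π C) = monomialIdeal (𝓐' k)) ∧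
      pairSupports 𝓐' ⊆ blowup.π C ⁻¹' pairSupports 𝓐 ∧
      numBad 𝓐' ≤ numBad 𝓐 ∧
      (badPairs (𝓐' i) (𝓐' j) = ∅ → numBad 𝓐' < numBad 𝓐) ∧
      (maxVal (𝓐' i) (𝓐' j) < maxVal (𝓐 i) (𝓐 j) ∨
        (maxVal (𝓐' i) (𝓐' j) = maxVal (𝓐 i) (𝓐 j) ∧ numMax (𝓐' i) (𝓐' j) < numMax (𝓐 i) (𝓐 j))) := by
  have hEi : HasSNC (boundaryOf (𝓐 i)) := (hb i).symm ▸ hEs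
  have hij : boundaryOf (𝓐 i) = boundaryOf (𝓐 j) := (hb i).trans (hb j).symm
  have hne : (badPairs (𝓐 i) (𝓐 j)).Nonempty := by
    obtain ⟨p, hp, -⟩ := hex
    exact ⟨p, hp⟩
  have hinej : i ≠ j := by
    rintro rfl
    rw [badPairs_self] at hne
    exact Finset.not_nonempty_empty hne
  obtain ⟨K, L, T, hKL, hTKL, hmeas⟩ := exists_step_explicit hEi hij hex
  obtain ⟨hK, hL, hbad⟩ := mem_badPairs_iff.mp hKL
  replace hK : K ∈ sheaves (𝓐 i) := hK
  replace hL : L ∈ sheaves (𝓐 j) := hL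
  replace hbad : IsBadPair (𝓐 i) (𝓐 j) K L := hbad
  have hT : ∀ G ∈ T, G ∈ Es := by
    intro G hG
    rcases (hTKL G).mp hG with rfl | rfl
    · exact (hb i) ▸ mem_sheaves_iff.mp hK
    · exact (hb j) ▸ mem_sheaves_iff.mp hL
  set C : X.IdealSheafData := T.sup id with hC
  have hπ : IsBlowup (blowup.π C) (T.sup id) := blowup.isBlowup C
  refine ⟨C, Es.map (strictTransformIdeal (blowup.π C) (T.sup id)) ++ [(T.sup id).comap (blowup.π C)],
    fun k => transformExp (𝓐 k) (blowup.π C) T 0, hEs.isRegular_subscheme_finsetSup T hT, ?_, ?_,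
    boundaryOf_transformExp_eq hb, fun k => comap_monomialIdeal_eq_transformExp ((hb k).symm ▸ hEs)
      (fun G hG => (hb k).symm ▸ hT G hG) hπ,
    pairSupports_transformExp_subset hEs hb hT hπ, numBad_transformExp_le hEs hb hT hπ,
    fun h => numBad_transformExp_lt hEs hb hT hπ hne h, hmeas⟩
  · -- the centre lies in the cosupport of the pair `(i, j)`
    intro x hx
    have hx' := (mem_support_finsetSup_iff T x).mp hx
    exact support_sup_subset_pairSupports 𝓐 hinej
      (mem_support_sup_of_isBadPair hK hL hbad (hx' K ((hTKL K).mpr (Or.inl rfl)))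
        (hx' L ((hTKL L).mpr (Or.inr rfl))))
  · have h := hasSNC_boundaryOf_transformExp ((hb i).symm ▸ hEs) (fun G hG => (hb i).symm ▸ hT G hG) hπ 0
    rwa [boundaryOf_transformExp, hb i] at h

/-- The family step on either side: if `(𝓐 i, 𝓐 j)` is incomparable, a step exists (on the `i`-side
or, by the symmetry of the measure, on the `j`-side). [folklore] -/
theorem exists_familyStep' (hEs : HasSNC Es) (hb : ∀ k, boundaryOf (𝓐 k) = Es) {i j : Fin r}
    (hne : (badPairs (𝓐 i) (𝓐 j)).Nonempty) :
    ∃ (C : X.IdealSheafData) (Es' : List (blowup C).IdealSheafData)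
      (𝓐' : Fin r → List ((blowup C).IdealSheafData × ℕ)),
      Scheme.IsRegular C.subscheme ∧ (C.support : Set X) ⊆ pairSupports 𝓐 ∧
      HasSNC Es' ∧ (∀ k, boundaryOf (𝓐' k) = Es') ∧
      (∀ k, (monomialIdeal (𝓐 k)).comap (blowup.π C) = monomialIdeal (𝓐' k)) ∧
      pairSupports 𝓐' ⊆ blowup.π C ⁻¹' pairSupports 𝓐 ∧
      numBad 𝓐' ≤ numBad 𝓐 ∧
      (badPairs (𝓐' i) (𝓐' j) = ∅ → numBad 𝓐' < numBad 𝓐) ∧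
      (maxVal (𝓐' i) (𝓐' j) < maxVal (𝓐 i) (𝓐 j) ∨
        (maxVal (𝓐' i) (𝓐' j) = maxVal (𝓐 i) (𝓐 j) ∧ numMax (𝓐' i) (𝓐' j) < numMax (𝓐 i) (𝓐 j))) := by
  obtain ⟨p₀, hp₀, hp₀v⟩ := exists_value_eq_maxVal hne
  rcases max_choice (expOf (𝓐 i) p₀.1 - expOf (𝓐 j) p₀.1) (expOf (𝓐 j) p₀.2 - expOf (𝓐 i) p₀.2)
    with h | h
  · exact exists_familyStep hEs hb ⟨p₀, hp₀, by rw [← hp₀v, value, h]⟩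
  · -- the `j`-side: step for the pair `(j, i)` and translate the measure back
    have hp₀' : p₀.swap ∈ badPairs (𝓐 j) (𝓐 i) := by
      rw [badPairs_swap]; exact Finset.mem_map_of_mem _ hp₀
    obtain ⟨C, Es', 𝓐', hC, hCsupp, hsnc, hb', hcomap, hpre, hnum, hflip, hmeas⟩ :=
      exists_familyStep hEs hb (i := j) (j := i)
        ⟨p₀.swap, hp₀', by rw [maxVal_swap, ← hp₀v, value, h, Prod.fst_swap]⟩
    refine ⟨C, Es', 𝓐', hC, hCsupp, hsnc, hb', hcomap, hpre, hnum, fun h0 => hflip ?_, ?_⟩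
    · rw [badPairs_swap, h0, Finset.map_empty]
    · rwa [maxVal_swap (𝓐' i) (𝓐' j), maxVal_swap (𝓐 i) (𝓐 j), numMax_swap (𝓐' i) (𝓐' j),
        numMax_swap (𝓐 i) (𝓐 j)] at hmeas

end FamilyStep

/-! ## The induction -/

section Induction

variable {r : ℕ}

/-- No incomparable pair: the empty sequence. [folklore] -/
theorem admitsFamilyPrincipalization_of_numBad_eq_zero {X : Scheme.{u}} {Es : List X.IdealSheafData}
    {𝓐 : Fin r → List (X.IdealSheafData × ℕ)} (hEs : HasSNC Es) (hb : ∀ k, boundaryOf (𝓐 k) = Es)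
    (h : numBad 𝓐 = 0) : AdmitsFamilyPrincipalization 𝓐 := by
  have hcomap : ∀ k, (monomialIdeal (𝓐 k)).comap (𝟙 X) = monomialIdeal (𝓐 k) := fun k =>
    Scheme.IdealSheafData.comap_id _
  exact ⟨CentreSeq.nil X, Es, 𝓐, trivial, trivial, hEs, hb, hcomap, numBad_eq_zero_iff.mp h⟩

/-- Prepending one blow-up to a family principalization on the blow-up. [folklore] -/
theorem AdmitsFamilyPrincipalization.cons {X : Scheme.{u}} {𝓐 : Fin r → List (X.IdealSheafData × ℕ)}
    (C : X.IdealSheafData) {𝓐₁ : Fin r → List ((blowup C).IdealSheafData × ℕ)}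
    (hC : Scheme.IsRegular C.subscheme) (hCsupp : (C.support : Set X) ⊆ pairSupports 𝓐)
    (hcomap : ∀ k, (monomialIdeal (𝓐 k)).comap (blowup.π C) = monomialIdeal (𝓐₁ k))
    (hpre : pairSupports 𝓐₁ ⊆ blowup.π C ⁻¹' pairSupports 𝓐) (h : AdmitsFamilyPrincipalization 𝓐₁) :
    AdmitsFamilyPrincipalization 𝓐 := by
  obtain ⟨s, Es', 𝓐', hreg, hover, hsnc, hb', hcomap', hgood⟩ := h
  refine ⟨CentreSeq.cons C s, Es', 𝓐', (CentreSeq.allRegular_cons C s).mpr ⟨hC, hreg⟩,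
    (CentreSeq.centresOver_cons C s _).mpr ⟨hCsupp, CentreSeq.CentresOver.mono s hpre hover⟩,
    hsnc, hb', fun k => ?_, hgood⟩
  have hk : (monomialIdeal (𝓐 k)).comap (s.comp ≫ blowup.π C) = monomialIdeal (𝓐' k) := by
    rw [Scheme.IdealSheafData.comap_comp, hcomap k, hcomap' k]
  exact hk

/-- **The nested induction**: outer on `numBad`, inner on the measure `(maxVal, numMax)` of a FIXED
incomparable index pair `(i, j)` — each family step either makes `(i, j)` comparable (outer measure
drops) or lowers its measure, never increasing `numBad`. [cite: Goward2005, §2] -/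
theorem family_aux (N : ℕ) : ∀ (X : Scheme.{u}) [IsLocallyNoetherian X] (Es : List X.IdealSheafData)
    (𝓐 : Fin r → List (X.IdealSheafData × ℕ)), HasSNC Es → (∀ k, boundaryOf (𝓐 k) = Es) →
    numBad 𝓐 = N → AdmitsFamilyPrincipalization 𝓐 := by
  induction N using Nat.strong_induction_on with
  | _ N ihN =>
  intro X _ Es 𝓐 hEs hb hN
  rcases Nat.eq_zero_or_pos N with rfl | hNpos
  · exact admitsFamilyPrincipalization_of_numBad_eq_zero hEs hb hN
  · -- the inner induction on the measure of a FIXED incomparable index pair `(i, j)`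
    have inner : ∀ (i j : Fin r) (M n : ℕ) (Y : Scheme.{u}) [IsLocallyNoetherian Y]
        (Fs : List Y.IdealSheafData) (𝓑 : Fin r → List (Y.IdealSheafData × ℕ)),
        HasSNC Fs → (∀ k, boundaryOf (𝓑 k) = Fs) → numBad 𝓑 ≤ N → (badPairs (𝓑 i) (𝓑 j)).Nonempty →
        maxVal (𝓑 i) (𝓑 j) = M → numMax (𝓑 i) (𝓑 j) = n → AdmitsFamilyPrincipalization 𝓑 := by
      intro i j M
      induction M using Nat.strong_induction_on with
      | _ M ihM =>
      intro n
      induction n using Nat.strong_induction_on with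
      | _ n ihn =>
      intro Y _ Fs 𝓑 hFs hb' hle hbad hM hn
      obtain ⟨C, Fs', 𝓑', hC, hCsupp, hsnc, hb'', hcomap, hpre, hnum, hflip, hmeas⟩ :=
        exists_familyStep' hFs hb' hbad
      haveI : IsLocallyNoetherian (blowup C) := CentreSeq.isLocallyNoetherian_blowup C
      refine AdmitsFamilyPrincipalization.cons C hC hCsupp hcomap hpre ?_
      by_cases hgood : badPairs (𝓑' i) (𝓑' j) = ∅
      · -- `(i, j)` became comparable: the outer measure dropped
        exact ihN (numBad 𝓑') (lt_of_lt_of_le (hflip hgood) hle) (blowup C) Fs' 𝓑' hsnc hb'' rfl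
      · have hbad' : (badPairs (𝓑' i) (𝓑' j)).Nonempty := Finset.nonempty_iff_ne_empty.mpr hgood
        rcases hmeas with hlt | ⟨heq, hlt⟩
        · exact ihM (maxVal (𝓑' i) (𝓑' j)) (hM ▸ hlt) (numMax (𝓑' i) (𝓑' j)) (blowup C) Fs' 𝓑' hsnc
            hb'' (hnum.trans hle) hbad' rfl rfl
        · exact ihn (numMax (𝓑' i) (𝓑' j)) (hn ▸ hlt) (blowup C) Fs' 𝓑' hsnc hb'' (hnum.trans hle)
            hbad' (heq.trans hM) rfl
    -- pick an incomparable index pair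
    have hne : (badIndexPairs 𝓐).Nonempty := by
      rw [← Finset.card_pos]
      change 0 < numBad 𝓐
      omega
    obtain ⟨p, hp⟩ := hne
    have hbad : (badPairs (𝓐 p.1) (𝓐 p.2)).Nonempty := mem_badIndexPairs_iff.mp hp
    exact inner p.1 p.2 (maxVal (𝓐 p.1) (𝓐 p.2)) (numMax (𝓐 p.1) (𝓐 p.2)) X Es 𝓐 hEs hb hN.le hbad
      rfl rfl

end Induction

/-! ## The theorems -/

section Theorems

variable {X : Scheme.{u}} [IsLocallyNoetherian X] {r : ℕ}

/-- **Principalization of a finite sum of monomial ideals by blowing up codimension-two strata**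
(predicate form). [cite: Goward2005, §2] [cite: Kollar2007, (3.111) Step 3] -/
theorem admitsFamilyPrincipalization {Es : List X.IdealSheafData} (hEs : HasSNC Es)
    (𝓐 : Fin r → List (X.IdealSheafData × ℕ)) (hb : ∀ k, boundaryOf (𝓐 k) = Es) :
    AdmitsFamilyPrincipalization 𝓐 :=
  family_aux _ X Es 𝓐 hEs hb rfl

/-- **Principalization of a finite sum of monomial ideals by blowing up codimension-two strata.** On a
locally Noetherian scheme `X`, let `𝓐 i` (`i : Fin r`) be exponent lists on one boundary `Es` with simple
normal crossings (so `X` is regular).  Then there is a finite sequence of blowings up with REGULAR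
centres — strata `V(K) ∩ V(L)` of two boundary divisors, inside the union `pairSupports 𝓐` of the
pairwise cosupports — after which the total transforms of the `monomialIdeal (𝓐 i)` are the monomial
ideals of exponent lists `𝓐' i` on a common simple normal crossings boundary, pairwise without bad pairs,
so that their sum (the total transform of `Σ_i monomialIdeal (𝓐 i)`) is LOCALLY PRINCIPAL.  Any
dimension; no base field, characteristic or excellence hypothesis. [cite: Goward2005, §2]
[cite: Kollar2007, (3.111) Step 3] -/
theorem exists_centreSeq_principalize_family {Es : List X.IdealSheafData} (hEs : HasSNC Es)
    (𝓐 : Fin r → List (X.IdealSheafData × ℕ)) (hb : ∀ k, boundaryOf (𝓐 k) = Es) :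
    ∃ (s : CentreSeq X) (Es' : List s.top.IdealSheafData) (𝓐' : Fin r → List (s.top.IdealSheafData × ℕ)),
      s.AllRegular ∧ s.CentresOver (pairSupports 𝓐) ∧ HasSNC Es' ∧ (∀ i, boundaryOf (𝓐' i) = Es') ∧
      (∀ i, (monomialIdeal (𝓐 i)).comap s.comp = monomialIdeal (𝓐' i)) ∧
      (∀ i j, badPairs (𝓐' i) (𝓐' j) = ∅) ∧
      IsLocallyPrincipal ((Finset.univ : Finset (Fin r)).sup fun i => monomialIdeal (𝓐' i)) := by
  obtain ⟨s, Es', 𝓐', hreg, hover, hsnc, hb', hcomap, hgood⟩ := admitsFamilyPrincipalization hEs 𝓐 hb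
  haveI : IsLocallyNoetherian s.top := by
    haveI : IsProper s.comp := CentreSeq.isProper_comp s
    exact LocallyOfFiniteType.isLocallyNoetherian s.comp
  exact ⟨s, Es', 𝓐', hreg, hover, hsnc, hb', hcomap, hgood,
    isLocallyPrincipal_finsetSup_of_forall_badPairs_eq_empty hsnc hb' hgood⟩

/-- Inverse image commutes with finite suprema of ideal sheaves. [folklore] -/
theorem comap_finsetSup {Y Z : Scheme.{u}} (f : Y ⟶ Z) {ι : Type*} (s : Finset ι)
    (J : ι → Z.IdealSheafData) : (s.sup J).comap f = s.sup fun i => (J i).comap f := by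
  classical
  induction s using Finset.induction_on with
  | empty => rw [Finset.sup_empty, Finset.sup_empty, Scheme.IdealSheafData.comap_bot]
  | insert a s ha ih => rw [Finset.sup_insert, Finset.sup_insert, Scheme.IdealSheafData.comap_sup, ih]

/-- **Corollary: the total transform of `Σ_i monomialIdeal (𝓐 i)` along the sequence is locally
principal, on a regular scheme.** [cite: Goward2005, §2] -/
theorem exists_centreSeq_isLocallyPrincipal_comap_finsetSup {Es : List X.IdealSheafData} (hEs : HasSNC Es)
    (𝓐 : Fin r → List (X.IdealSheafData × ℕ)) (hb : ∀ k, boundaryOf (𝓐 k) = Es) :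
    ∃ s : CentreSeq X, s.AllRegular ∧ s.CentresOver (pairSupports 𝓐) ∧ Scheme.IsRegular s.top ∧
      IsLocallyPrincipal
        (((Finset.univ : Finset (Fin r)).sup fun i => monomialIdeal (𝓐 i)).comap s.comp) := by
  obtain ⟨s, Es', 𝓐', hreg, hover, hsnc, -, hcomap, -, hlp⟩ := exists_centreSeq_principalize_family hEs 𝓐 hb
  refine ⟨s, hreg, hover, fun x => (hsnc x).1, ?_⟩
  rw [comap_finsetSup]
  have h : (fun i => (monomialIdeal (𝓐 i)).comap s.comp) = fun i => monomialIdeal (𝓐' i) :=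
    funext hcomap
  rw [h]
  exact hlp

omit [IsLocallyNoetherian X] in
/-- The exponent list of an exponent FUNCTION on a boundary. [folklore] -/
theorem boundaryOf_map_ofFun (Es : List X.IdealSheafData) (e : X.IdealSheafData → ℕ) :
    boundaryOf (Es.map fun K => (K, e K)) = Es := by
  simp [boundaryOf, List.map_map, Function.comp_def]

/-- **Exponent-function form**: for an snc boundary `Es` and exponent functions `e i` (`i : Fin r`),
the sum of the monomial ideals `Π_{K ∈ Es} 𝓘_K^{e i K}` is principalized by codimension-two strata
blow-ups. [cite: Goward2005, §2] -/
theorem exists_centreSeq_principalize_ofFun {Es : List X.IdealSheafData} (hEs : HasSNC Es)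
    (e : Fin r → X.IdealSheafData → ℕ) :
    ∃ s : CentreSeq X, s.AllRegular ∧
      s.CentresOver (pairSupports fun i => Es.map fun K => (K, e i K)) ∧ Scheme.IsRegular s.top ∧
      IsLocallyPrincipal
        (((Finset.univ : Finset (Fin r)).sup fun i => monomialIdeal (Es.map fun K => (K, e i K))).comap
          s.comp) :=
  exists_centreSeq_isLocallyPrincipal_comap_finsetSup hEs _ fun _ => boundaryOf_map_ofFun Es _

/-- **The pair in exponent-function form** (for consumers holding one boundary list and two exponent
functions): `Π 𝓘_K^{a K} + Π 𝓘_K^{b K}` is principalized, with centres inside its cosupport.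
[cite: Goward2005, §2] -/
theorem exists_centreSeq_principalize_pair_ofFun {Es : List X.IdealSheafData} (hEs : HasSNC Es)
    (a b : X.IdealSheafData → ℕ) :
    ∃ s : CentreSeq X, s.AllRegular ∧
      s.CentresOver ((monomialIdeal (Es.map fun K => (K, a K)) ⊔
        monomialIdeal (Es.map fun K => (K, b K))).support : Set X) ∧ Scheme.IsRegular s.top ∧
      IsLocallyPrincipal ((monomialIdeal (Es.map fun K => (K, a K)) ⊔
        monomialIdeal (Es.map fun K => (K, b K))).comap s.comp) :=
  exists_centreSeq_isLocallyPrincipal_comap _ _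
    ((boundaryOf_map_ofFun Es a).trans (boundaryOf_map_ofFun Es b).symm)
    ((boundaryOf_map_ofFun Es a).symm ▸ hEs)

end Theorems

end MonomialCleanup

end Summit.ResolutionOfSingularities.ResolutionOfSingularities.Theorems

end
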